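import Literature.Topology.FourManifolds.CircleTubeUniqueness
import Literature.Topology.FourManifolds.LickorishTwistLink
import Literature.Topology.FourManifolds.IsotopyProofs
import Literature.Topology.FourManifolds.InverseFunctionTheorem
import Literature.Topology.FourManifolds.SmoothEmbeddingCriteria
import Literature.Topology.FourManifolds.KnotsProofs
import HarnessLib

/-!
# Matching two tubes around unknotted circles in `S³` by a diffeotopy, I: the cores

Topic `Literature/Topology/FourManifolds` (fact seat
`provefact-Literature.Topology.FourManifolds.exists-762b5f508d` of the named fact
`exists_framedKnot_of_hasHandleDecomposition_oneZeroOne`, `PropertyRTraceClosing.lean`; first file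
of the matching step of the uniqueness of the trace of the `0`-framed unknot — two tubes
`S¹ × ℝ² ↪ S³` with unknotted cores and equal framings are carried onto one another near their
cores, up to a reflection of the fibre, by a diffeotopy of `S³`; Kosinski, *Differential
Manifolds* (1993), VI (6.6): *"if the attaching spheres are isotopic the resulting manifolds are
diffeomorphic"*, with III (3.5), the uniqueness of tubular neighbourhoods).  Everything in this
file is **proved**; the only definition is the tube of §2 (a `CircleTube` structure on a
smoothly embedded tube); no named fact is introduced.

This file does the CORES:

* §1 `exists_diffeotopy_comp_eq_of_isUnknot` — two unknotted knots `K₁`, `K₂ : S¹ ↪ S³`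
  (`Knot.IsUnknot`: ambient isotopic to the standard circle) are carried onto one another,
  `D₁ ∘ K₁ = K₂`, by a **diffeotopy** `D` of `S³` (`Diffeotopy (𝓡 3) (𝕊 3)`: a level-preserving
  diffeomorphism of `ℝ × S³`): compose the two ambient isotopies (`IsAmbientIsotopic.trans_holds`,
  `IsAmbientIsotopic.symm_holds`, Hirsch 1976, §8.1) and pass from an ambient isotopy to a
  diffeotopy by the inverse function theorem (`AmbientIsotopy.toDiffeotopy`).
* §2 `CircleTube.ofTube hT` — a smoothly embedded tube `T : S¹ × ℝ² ↪ S³` (an open embedding by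
  invariance of domain, `LickorishTwist.isOpenEmbedding_of_tube`) restricted to the unit tube,
  as a `CircleTube (𝕊 3)` (`CircleTubeTransition.lean`): its inverse is smooth on the range
  (`contMDiffOn_symm_of_isSmoothEmbedding`); its core is the core knot
  `LickorishTwist.knotOfTube hT`.
* §3 `exists_diffeotopy_tube_comp_eq_of_isUnknot` — for two tubes `T₁`, `T₂` with unknotted
  core knots, a diffeotopy `D` of `S³` with `D₁ (T₁ (x, 0)) = T₂ (x, 0)`; the transported tube
  `D₁ ∘ T₁` is again a smoothly embedded tube (`IsSmoothEmbedding.diffeomorph_comp`) and the two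
  `CircleTube`s `ofTube (D₁ ∘ T₁)`, `ofTube T₂` have **the same core** — the hypothesis `hcore`
  of the tube-uniqueness theorems `CircleTube.exists_diffeotopy_tubeFrame` /
  `CircleTube.exists_diffeotopy_reflect` (`CircleTubeUniqueness.lean`), which match the fibres
  in the sequel.

## References

* A. A. Kosinski, *Differential Manifolds* (1993), III (3.5), VI (6.6). [Kosinski1993]
* M. W. Hirsch, *Differential Topology*, GTM 33 (1976), Ch. 8 §1 (isotopy, ambient isotopy,
  diffeotopy; Thm. 1.3). [HirschDT1976]
-/

noncomputable section

open Set Function Metric Filter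
open scoped Manifold ContDiff Topology

namespace Literature.Topology.FourManifolds

/-! ### §1 Two unknotted knots are related by a diffeotopy of `S³` -/

section Knots

/-- **Two unknotted knots are carried onto one another by a diffeotopy of `S³`.**  If `K₁`
and `K₂` are both ambient isotopic to the standard circle (`Knot.IsUnknot`), then
`K₁ ~ unknot ~ K₂` by symmetry and transitivity of ambient isotopy (Hirsch 1976, §8.1;
`IsAmbientIsotopic.symm_holds`, `IsAmbientIsotopic.trans_holds`), and the composite ambient
isotopy of the closed manifold `S³` is a diffeotopy (`AmbientIsotopy.toDiffeotopy`: the track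
`(t, y) ↦ (t, F_t y)` is a diffeomorphism of `ℝ × S³` by the inverse function theorem).
[cite: HirschDT1976, Ch. 8 §1 (p. 178)] -/
theorem exists_diffeotopy_comp_eq_of_isUnknot {K₁ K₂ : Knot} (h₁ : K₁.IsUnknot) (h₂ : K₂.IsUnknot) :
    ∃ D : Diffeotopy (𝓡 3) (Metric.sphere (0 : EuclideanSpace ℝ (Fin 4)) 1), D.toFun 1 ∘ ⇑K₁ = ⇑K₂ := by
  have h : IsAmbientIsotopic (𝓡 1) (𝓡 3) ⇑K₁ ⇑K₂ :=
    IsAmbientIsotopic.trans_holds h₁ (IsAmbientIsotopic.symm_holds h₂)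
  obtain ⟨F, hF⟩ := h
  exact ⟨F.toDiffeotopy, by rw [AmbientIsotopy.toDiffeotopy_toFun]; exact hF⟩

end Knots

/-! ### §2 A smoothly embedded tube in `S³` as a `CircleTube` -/

namespace CircleTube

variable {T : (Metric.sphere (0 : EuclideanSpace ℝ (Fin 2)) 1) × EuclideanSpace ℝ (Fin 2) →
    Metric.sphere (0 : EuclideanSpace ℝ (Fin 4)) 1}
  (hT : Manifold.IsSmoothEmbedding ((𝓡 1).prod 𝓘(ℝ, EuclideanSpace ℝ (Fin 2))) (𝓡 3) ∞ T)

/-- A base point of the tube (for `Nonempty`). [folklore] -/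
instance instNonemptyTubeSource :
    Nonempty ((Metric.sphere (0 : EuclideanSpace ℝ (Fin 2)) 1) × EuclideanSpace ℝ (Fin 2)) :=
  ⟨(⟨EuclideanSpace.single 0 1, by simp⟩, 0)⟩

/-- **A smoothly embedded tube `T : S¹ × ℝ² ↪ S³`, restricted to the unit tube, as a tube around
its core circle** (`CircleTube`; Kosinski 1993, III §1–3): `T` is an open embedding (invariance
of domain, `1 + 2 = 3`: `LickorishTwist.isOpenEmbedding_of_tube`), so it is an open partial
homeomorphism onto its range with smooth inverse there (`contMDiffOn_symm_of_isSmoothEmbedding`),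
and we restrict it to the open unit tube `S¹ × B(0, 1)`. [cite: Kosinski1993, III (3.1)] -/
def ofTube : CircleTube (Metric.sphere (0 : EuclideanSpace ℝ (Fin 4)) 1) where
  toHomeo := ((LickorishTwist.isOpenEmbedding_of_tube hT).toOpenPartialHomeomorph T).restrOpen
    ((univ : Set (Metric.sphere (0 : EuclideanSpace ℝ (Fin 2)) 1)) ×ˢ
      ball (0 : EuclideanSpace ℝ (Fin 2)) 1) (isOpen_univ.prod isOpen_ball)
  source_eq := by
    rw [OpenPartialHomeomorph.restrOpen_source,
      Topology.IsOpenEmbedding.toOpenPartialHomeomorph_source, univ_inter]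
  contMDiffOn_toHomeo := by
    rw [OpenPartialHomeomorph.coe_restrOpen, Topology.IsOpenEmbedding.toOpenPartialHomeomorph_apply]
    exact hT.contMDiff.contMDiffOn
  contMDiffOn_symm := by
    rw [OpenPartialHomeomorph.coe_restrOpen_symm]
    refine (contMDiffOn_symm_of_isSmoothEmbedding hT (LickorishTwist.isOpenEmbedding_of_tube hT)).mono
      fun y hy => ?_
    have hy' := hy.1
    rwa [Topology.IsOpenEmbedding.toOpenPartialHomeomorph_target] at hy'

/-- The tube of `ofTube` is `T`, as a function. [folklore] -/
@[simp] theorem ofTube_apply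
    (q : (Metric.sphere (0 : EuclideanSpace ℝ (Fin 2)) 1) × EuclideanSpace ℝ (Fin 2)) :
    (ofTube hT).toHomeo q = T q := rfl

/-- The core of `ofTube` is the core knot `x ↦ T (x, 0)` of the tube
(`LickorishTwist.knotOfTube`). [folklore] -/
theorem ofTube_core (x : Metric.sphere (0 : EuclideanSpace ℝ (Fin 2)) 1) :
    (ofTube hT).core x = LickorishTwist.knotOfTube hT x := rfl

/-- The core of `ofTube`, pointwise. [folklore] -/
@[simp] theorem ofTube_core_apply (x : Metric.sphere (0 : EuclideanSpace ℝ (Fin 2)) 1) :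
    (ofTube hT).core x = T (x, 0) := rfl

/-- The target of `ofTube` is contained in the range of the tube. [folklore] -/
theorem ofTube_target_subset_range : (ofTube hT).toHomeo.target ⊆ range T := by
  intro y hy
  have hy' : y ∈ ((LickorishTwist.isOpenEmbedding_of_tube hT).toOpenPartialHomeomorph T).target := hy.1
  rwa [Topology.IsOpenEmbedding.toOpenPartialHomeomorph_target] at hy'

/-- The target of `ofTube` is the image of the open unit tube. [folklore] -/
theorem ofTube_target_eq_image : (ofTube hT).toHomeo.target =
    T '' ((univ : Set (Metric.sphere (0 : EuclideanSpace ℝ (Fin 2)) 1)) ×ˢ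
      ball (0 : EuclideanSpace ℝ (Fin 2)) 1) := by
  rw [← (ofTube hT).toHomeo.image_source_eq_target, (ofTube hT).source_eq]
  rfl

/-- A point `T (x, w)` with `‖w‖ < 1` lies in the target of `ofTube`. [folklore] -/
theorem apply_mem_ofTube_target (x : Metric.sphere (0 : EuclideanSpace ℝ (Fin 2)) 1)
    {w : EuclideanSpace ℝ (Fin 2)} (hw : ‖w‖ < 1) : T (x, w) ∈ (ofTube hT).toHomeo.target := by
  rw [← ofTube_apply hT]
  exact (ofTube hT).toHomeo.map_source ((ofTube hT).mem_source_iff.2 hw)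

/-- The inverse of `ofTube` on points of the unit tube. [folklore] -/
theorem ofTube_symm_apply (x : Metric.sphere (0 : EuclideanSpace ℝ (Fin 2)) 1)
    {w : EuclideanSpace ℝ (Fin 2)} (hw : ‖w‖ < 1) : (ofTube hT).toHomeo.symm (T (x, w)) = (x, w) := by
  rw [← ofTube_apply hT]
  exact (ofTube hT).toHomeo.left_inv ((ofTube hT).mem_source_iff.2 hw)

end CircleTube

/-! ### §3 Two tubes with unknotted cores: matching the cores -/

section Tubes

variable {T₁ T₂ : (Metric.sphere (0 : EuclideanSpace ℝ (Fin 2)) 1) × EuclideanSpace ℝ (Fin 2) →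
    Metric.sphere (0 : EuclideanSpace ℝ (Fin 4)) 1}
  (hT₁ : Manifold.IsSmoothEmbedding ((𝓡 1).prod 𝓘(ℝ, EuclideanSpace ℝ (Fin 2))) (𝓡 3) ∞ T₁)
  (hT₂ : Manifold.IsSmoothEmbedding ((𝓡 1).prod 𝓘(ℝ, EuclideanSpace ℝ (Fin 2))) (𝓡 3) ∞ T₂)

include hT₁ hT₂ in
/-- **Two tubes in `S³` with unknotted core knots: a diffeotopy of `S³` carrying the first core
onto the second**, `D₁ (T₁ (x, 0)) = T₂ (x, 0)` (§1 applied to the core knots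
`LickorishTwist.knotOfTube hTᵢ = Tᵢ (·, 0)`). [cite: HirschDT1976, Ch. 8 §1 (p. 178)]
[cite: Kosinski1993, VI (6.6)] -/
theorem exists_diffeotopy_tube_comp_eq_of_isUnknot
    (h₁ : (LickorishTwist.knotOfTube hT₁).IsUnknot) (h₂ : (LickorishTwist.knotOfTube hT₂).IsUnknot) :
    ∃ D : Diffeotopy (𝓡 3) (Metric.sphere (0 : EuclideanSpace ℝ (Fin 4)) 1),
      ∀ x, D.toFun 1 (T₁ (x, 0)) = T₂ (x, 0) := by
  obtain ⟨D, hD⟩ := exists_diffeotopy_comp_eq_of_isUnknot h₁ h₂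
  exact ⟨D, fun x => congr_fun hD x⟩

include hT₁ in
/-- **A tube transported by a diffeomorphism of `S³` is a smoothly embedded tube.** [folklore] -/
theorem isSmoothEmbedding_diffeomorph_comp_tube
    (Ψ : Metric.sphere (0 : EuclideanSpace ℝ (Fin 4)) 1 ≃ₘ⟮𝓡 3, 𝓡 3⟯
      Metric.sphere (0 : EuclideanSpace ℝ (Fin 4)) 1) :
    Manifold.IsSmoothEmbedding ((𝓡 1).prod 𝓘(ℝ, EuclideanSpace ℝ (Fin 2))) (𝓡 3) ∞ (⇑Ψ ∘ T₁) :=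
  hT₁.diffeomorph_comp Ψ

include hT₂ in
/-- **After the diffeotopy the two tubes have the same core**: with `D` as in
`exists_diffeotopy_tube_comp_eq_of_isUnknot`, the `CircleTube`s of the transported tube
`D₁ ∘ T₁` and of `T₂` satisfy the hypothesis `hcore` of the tube-uniqueness theorems of
`CircleTubeUniqueness.lean`. [cite: Kosinski1993, III (3.5)] -/
theorem ofTube_core_eq_of_apply_zero_eq
    (D : Diffeotopy (𝓡 3) (Metric.sphere (0 : EuclideanSpace ℝ (Fin 4)) 1))
    (hD : ∀ x, D.toFun 1 (T₁ (x, 0)) = T₂ (x, 0)) (x : Metric.sphere (0 : EuclideanSpace ℝ (Fin 2)) 1) :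
    (CircleTube.ofTube (isSmoothEmbedding_diffeomorph_comp_tube hT₁ (D.stage 1))).core x =
      (CircleTube.ofTube hT₂).core x := by
  rw [CircleTube.ofTube_core_apply, CircleTube.ofTube_core_apply, comp_apply, Diffeotopy.coe_stage]
  exact hD x

include hT₁ hT₂ in
/-- **Summary of the core matching**: for two tubes in `S³` with unknotted core knots there are
a diffeomorphism `Ψ` of `S³`, diffeotopic to the identity (the end `D₁` of a diffeotopy `D`),
such that the transported tube `Ψ ∘ T₁` is a smoothly embedded tube whose `CircleTube` has the
same core as that of `T₂`. [cite: Kosinski1993, VI (6.6) with III (3.5)] -/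
theorem exists_diffeotopy_ofTube_core_eq
    (h₁ : (LickorishTwist.knotOfTube hT₁).IsUnknot) (h₂ : (LickorishTwist.knotOfTube hT₂).IsUnknot) :
    ∃ (D : Diffeotopy (𝓡 3) (Metric.sphere (0 : EuclideanSpace ℝ (Fin 4)) 1))
      (hT₁' : Manifold.IsSmoothEmbedding ((𝓡 1).prod 𝓘(ℝ, EuclideanSpace ℝ (Fin 2))) (𝓡 3) ∞
        (D.toFun 1 ∘ T₁)),
      ∀ x, (CircleTube.ofTube hT₁').core x = (CircleTube.ofTube hT₂).core x := by
  obtain ⟨D, hD⟩ := exists_diffeotopy_tube_comp_eq_of_isUnknot hT₁ hT₂ h₁ h₂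
  exact ⟨D, isSmoothEmbedding_diffeomorph_comp_tube hT₁ (D.stage 1),
    ofTube_core_eq_of_apply_zero_eq hT₁ hT₂ D hD⟩

end Tubes

end Literature.Topology.FourManifolds
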